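import Summits.HubbardSuperconductivity.HubbardSuperconductivity.Theorems.AnisotropyChordTransferFibre3FinXDCheck

/-!
# Route `AnisotropyChord` / H0 rotor rung: FIN per-`L` row-D (KT-2a″) SUB-CELL facts, `L = 9` (72–77)

Row-D facts `xdCellAny0 9 (49/50) la lb aD = true` on quarter sub-cells of the combined cells whose side condition needs `aD ≈ .04` (mechhunt STATUS p3 g7 REPORT 3).
Prover seat `hubbard-h0-rotor-p3` g7; helper for piece A = stmt-HubbardSuperconductivity-23918 of rung 19089 (`--supports`, helper class).
WHAT THIS IS NOT: nothing here proves superconductivity in the Hubbard model (rotor TARGET as worded stays FALSE, g15 verdict); kernel facts /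
assembly for ONE conditional reduction at one `L`.  No sorry.
-/

set_option linter.dupNamespace false
set_option autoImplicit false

namespace Summit.HubbardSuperconductivity.HubbardSuperconductivity.Theorems.AnisotropyChord.Transfer.Fibre3

namespace FinXD

/-- row-D sub-cell `[16775436884237569, 16880283364764053]` of `L = 9`. [folklore] -/
theorem xd9s_129_0 : xdCellAny0 9 (49/50 : ℚ) 16775436884237569 16880283364764053 (1/25 : ℚ) = true := by decide +kernel

/-- row-D sub-cell `[16880283364764053, 16985129845290538]` of `L = 9`. [folklore] -/
theorem xd9s_129_1 : xdCellAny0 9 (49/50 : ℚ) 16880283364764053 16985129845290538 (1/25 : ℚ) = true := by decide +kernel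

/-- row-D sub-cell `[16985129845290538, 17089976325817022]` of `L = 9`. [folklore] -/
theorem xd9s_129_2 : xdCellAny0 9 (49/50 : ℚ) 16985129845290538 17089976325817022 (1/25 : ℚ) = true := by decide +kernel

/-- row-D sub-cell `[17089976325817022, 17194822806343507]` of `L = 9`. [folklore] -/
theorem xd9s_129_3 : xdCellAny0 9 (49/50 : ℚ) 17089976325817022 17194822806343507 (1/25 : ℚ) = true := by decide +kernel

/-- row-D sub-cell `[17194822806343507, 17302290448883154]` of `L = 9`. [folklore] -/
theorem xd9s_130_0 : xdCellAny0 9 (49/50 : ℚ) 17194822806343507 17302290448883154 (1/25 : ℚ) = true := by decide +kernel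

/-- row-D sub-cell `[17302290448883154, 17409758091422801]` of `L = 9`. [folklore] -/
theorem xd9s_130_1 : xdCellAny0 9 (49/50 : ℚ) 17302290448883154 17409758091422801 (1/25 : ℚ) = true := by decide +kernel

end FinXD

end Summit.HubbardSuperconductivity.HubbardSuperconductivity.Theorems.AnisotropyChord.Transfer.Fibre3
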